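import Mathlib.Analysis.SpecialFunctions.Pow.Deriv
import Mathlib.Analysis.SpecialFunctions.Complex.Arg
import Mathlib.Analysis.SpecialFunctions.Exp
import Mathlib.Analysis.SpecialFunctions.Pow.Asymptotics
import Literature.NumberTheory.Transcendental.HypersurfaceCover
import Summits.Schanuel.Schanuel.Theorems.ZilberEacComplexPunctureDecouplingLemmas
import Literature.NumberTheory.Transcendental.ExpVarieties
import Literature.ModelTheory.ExponentialFields.Languages
import Summits.Schanuel.Schanuel.Theorems.ZilberEacComplexEscapeLemmas
import HarnessLib

/-!
# EC by escape to infinity: quadric graph bases, fibres Laurent in `yₙ` with constant top term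

Extension of `exists_expPoint_quadricEscape_powers` (`ZilberEacComplexQuadricEscapePowers.lean`) to fibres
`yⱼ = y_{s+1}^{κⱼ} (cⱼ + Σ_{i<K} A_{j,i}(x') y_{s+1}^{-(i+1)})` over the quadric graph `x_{s+1} = xᵀMx + b·x + c₀`
(for `K ≤ κⱼ`: all polynomials in `(x', y_{s+1})` of `y_{s+1}`-degree `κⱼ` with CONSTANT top coefficient
`cⱼ ≠ 0`), under `κᵀMκ ≠ 0`, `κⱼ ≥ 1`; escape `xⱼ = κⱼτ + log cⱼ + ζⱼ`, perturbation
`Σᵢ A_{j,i}(x)e^{-(i+1)τ}/cⱼ → 0` as `Re τ → +∞`. No lattice hypothesis. First open rung of EAC: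
Mantova–Masser, PLMS 129 (2024), §1 p. 5. HONEST FRAMING: a modest sub-rung of EAC; no bearing on Schanuel.
-/

noncomputable section
open Complex MvPolynomial Metric Set Filter Topology

set_option linter.dupNamespace false

namespace Summit.Schanuel.Schanuel.Theorems

/-! ### The escape theorem -/

set_option maxHeartbeats 400000 in
/-- **EC by escape to infinity: quadric graph base, fibres with constant top `yₙ`-coefficient.** For
`M`, `b`, `c₀`, positive integers `κⱼ` with `Σᵢⱼ Mᵢⱼκᵢκⱼ ≠ 0`, `cⱼ ≠ 0` and arbitrary `A_{j,i} ∈ ℂ[x']`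
(`i < K`), with `w = e^{g(x)}`, `g = xᵀMx + b·x + c₀`, the system `exp xⱼ = w^{κⱼ}(cⱼ + Σᵢ A_{j,i}(x) w^{-(i+1)})`
has a solution: EC for `V = {x_{s+1} = g(x'), yⱼ = y_{s+1}^{κⱼ}(cⱼ + Σᵢ A_{j,i}(x') y_{s+1}^{-(i+1)})}`
(`dim π₁ V = n - 1`, Mantova–Masser 2024 §1 p. 5), no lattice hypothesis. New.
[cite: MantovaMasser2023, §1 p.5 (the open case dim π(V) = 2 in ℂ³×ℂˣ³)] -/
theorem exists_expPoint_quadricEscape_laurent {s K : ℕ} (M : Fin s → Fin s → ℂ) (b : Fin s → ℂ)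
    (c₀ : ℂ) (κ : Fin s → ℕ) (hκ : ∀ j, 0 < κ j)
    (hα : ∑ i, ∑ j, M i j * (κ i : ℂ) * (κ j : ℂ) ≠ 0)
    (c : Fin s → ℂ) (hc : ∀ j, c j ≠ 0) (A : Fin s → Fin K → MvPolynomial (Fin s) ℂ) :
    ∃ x : Fin s → ℂ, ∀ j,
      exp (x j) = exp (∑ i, ∑ l, M i l * x i * x l + ∑ i, b i * x i + c₀) ^ (κ j) *
        (c j + ∑ i : Fin K, eval x (A j i) *
          (exp (∑ i, ∑ l, M i l * x i * x l + ∑ i, b i * x i + c₀) ^ ((i : ℕ) + 1))⁻¹) := by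
  classical
  set α : ℂ := ∑ i, ∑ j, M i j * (κ i : ℂ) * (κ j : ℂ) with hαdef
  set Kk : ℝ := ∑ j, (κ j : ℝ) with hKk
  have hKk0 : 0 ≤ Kk := by positivity
  have hκK : ∀ j, (κ j : ℝ) ≤ Kk := fun j =>
    Finset.single_le_sum (f := fun j => (κ j : ℝ)) (fun i _ => by positivity) (Finset.mem_univ j)
  have hκ1 : ∀ j, (1 : ℝ) ≤ κ j := fun j => by exact_mod_cast hκ j
  set g : (Fin s → ℂ) → ℂ := fun x => ∑ i, ∑ l, M i l * x i * x l + ∑ i, b i * x i + c₀ with hgdef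
  set ℓ : Fin s → ℂ := fun j => log (c j) with hℓ
  have hexpℓ : ∀ j, exp (ℓ j) = c j := fun j => Complex.exp_log (hc j)
  obtain ⟨σ, hσ, hσre⟩ := exists_sign_re_nonneg α
  set Dσ : ℂ := -(I * σ) / α with hDσ
  have hσabs : |σ| = 1 := by rcases hσ with h | h <;> simp [h]
  have hDσnorm : ‖Dσ‖ = ‖α‖⁻¹ := by
    rw [hDσ, norm_div, norm_neg, norm_mul, Complex.norm_I, Complex.norm_real, Real.norm_eq_abs,
      hσabs, one_mul, one_div]
  have hα0 : 0 < ‖α‖ := norm_pos_iff.mpr hα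
  have hDσpos : 0 < ‖Dσ‖ := by rw [hDσnorm]; positivity
  have hgrowth := fun j i =>
    Literature.NumberTheory.Transcendental.HypersurfaceCover.exists_norm_eval_le_pow (A j i)
  choose CA hCA NA hCNA using hgrowth
  set βf : (Fin s → ℂ) → ℂ := fun v =>
    ∑ i, ∑ l, M i l * ((κ i : ℂ) * v l + (κ l : ℂ) * v i) + ∑ i, b i * (κ i : ℂ) with hβf
  obtain ⟨B, hB0, hB⟩ : ∃ B : ℝ, 0 ≤ B ∧ ∀ ζ : Fin s → ℂ, ‖ζ‖ ≤ 1 →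
      ‖(βf (ℓ + ζ) - 1) / (2 * α)‖ ≤ B ∧ ‖((βf (ℓ + ζ) - 1) / (2 * α)) ^ 2 - g (ℓ + ζ) / α‖ ≤ B ∧
        ‖ℓ + ζ‖ ≤ B := by
    have hcont1 : Continuous fun ζ : Fin s → ℂ => (βf (ℓ + ζ) - 1) / (2 * α) := by simp only [hβf]; fun_prop
    have hcont2 : Continuous fun ζ : Fin s → ℂ =>
        ((βf (ℓ + ζ) - 1) / (2 * α)) ^ 2 - g (ℓ + ζ) / α := by
      simp only [hβf, hgdef]; fun_prop
    obtain ⟨B₁, hB₁⟩ := (isCompact_closedBall (0 : Fin s → ℂ) 1).exists_bound_of_continuousOn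
      hcont1.continuousOn
    obtain ⟨B₂, hB₂⟩ := (isCompact_closedBall (0 : Fin s → ℂ) 1).exists_bound_of_continuousOn
      hcont2.continuousOn
    refine ⟨max (max B₁ B₂) (‖ℓ‖ + 1), by positivity, fun ζ hζ => ⟨?_, ?_, ?_⟩⟩
    · exact (hB₁ ζ (by rwa [mem_closedBall, dist_zero_right])).trans
        ((le_max_left _ _).trans (le_max_left _ _))
    · exact (hB₂ ζ (by rwa [mem_closedBall, dist_zero_right])).trans
        ((le_max_right _ _).trans (le_max_left _ _))
    · exact ((norm_add_le _ _).trans (by linarith)).trans (le_max_right _ _)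
  have hε : (0 : ℝ) < 1 / (16 * ((s : ℝ) + 1)) := by positivity
  have hεK : (0 : ℝ) < 1 / (16 * ((s : ℝ) + 1)) / ((K : ℝ) + 1) := by positivity
  have hsmall : ∀ j i, ∀ᶠ k : ℕ in atTop,
      CA j i / ‖c j‖ * (Kk * (2 * B + Real.sqrt ((2 * Real.pi * ‖Dσ‖ + 1) * k)) + B + 1) ^ NA j i *
        Real.exp (-(Real.sqrt (Real.pi * ‖Dσ‖ * k) - B - 1)) ≤
          1 / (16 * ((s : ℝ) + 1)) / ((K : ℝ) + 1) := by
    intro j i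
    have hu : Tendsto (fun k : ℕ => Real.sqrt (Real.pi * ‖Dσ‖ * k)) atTop atTop := by
      refine Real.tendsto_sqrt_atTop.comp ?_
      exact tendsto_natCast_atTop_atTop.const_mul_atTop (by positivity)
    set L : ℝ := Kk * (2 * B) + Kk * Real.sqrt ((2 * Real.pi * ‖Dσ‖ + 1) / (Real.pi * ‖Dσ‖)) + B + 1
      with hL
    have hL0 : 0 ≤ L := by positivity
    have hdom : ∀ k : ℕ, Kk * (2 * B + Real.sqrt ((2 * Real.pi * ‖Dσ‖ + 1) * k)) + B + 1 ≤
        L * (1 + Real.sqrt (Real.pi * ‖Dσ‖ * k)) := by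
      intro k
      have h1 : Real.sqrt ((2 * Real.pi * ‖Dσ‖ + 1) * k) =
          Real.sqrt ((2 * Real.pi * ‖Dσ‖ + 1) / (Real.pi * ‖Dσ‖)) * Real.sqrt (Real.pi * ‖Dσ‖ * k) := by
        rw [← Real.sqrt_mul (by positivity)]
        congr 1
        field_simp
      rw [h1]
      have hr0 := Real.sqrt_nonneg ((2 * Real.pi * ‖Dσ‖ + 1) / (Real.pi * ‖Dσ‖))
      have hS0 := Real.sqrt_nonneg (Real.pi * ‖Dσ‖ * k)
      set r := Real.sqrt ((2 * Real.pi * ‖Dσ‖ + 1) / (Real.pi * ‖Dσ‖))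
      set S := Real.sqrt (Real.pi * ‖Dσ‖ * k)
      have hL1 : Kk * (2 * B) + B + 1 ≤ L := by rw [hL]; nlinarith
      have hL2 : Kk * r ≤ L := by rw [hL]; nlinarith
      have h3 : Kk * (2 * B + r * S) + B + 1 = (Kk * (2 * B) + B + 1) + (Kk * r) * S := by ring
      rw [h3]
      nlinarith [mul_le_mul_of_nonneg_right hL2 hS0]
    have hlim := tendsto_one_add_pow_mul_exp_neg (NA j i)
    have hlim2 : Tendsto (fun k : ℕ => CA j i / ‖c j‖ * L ^ NA j i * Real.exp (B + 1) *
        ((1 + Real.sqrt (Real.pi * ‖Dσ‖ * k)) ^ NA j i *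
          Real.exp (-Real.sqrt (Real.pi * ‖Dσ‖ * k)))) atTop (𝓝 0) := by
      have := (hlim.comp hu).const_mul (CA j i / ‖c j‖ * L ^ NA j i * Real.exp (B + 1))
      rw [mul_zero] at this; exact this
    refine (hlim2.eventually (eventually_le_nhds hεK)).mono fun k hk => le_trans ?_ hk
    have hcj : 0 < ‖c j‖ := norm_pos_iff.mpr (hc j)
    have h1 : (Kk * (2 * B + Real.sqrt ((2 * Real.pi * ‖Dσ‖ + 1) * k)) + B + 1) ^ NA j i ≤
        (L * (1 + Real.sqrt (Real.pi * ‖Dσ‖ * k))) ^ NA j i :=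
      pow_le_pow_left₀ (by positivity) (hdom k) _
    have h2 : Real.exp (-(Real.sqrt (Real.pi * ‖Dσ‖ * k) - B - 1)) =
        Real.exp (B + 1) * Real.exp (-Real.sqrt (Real.pi * ‖Dσ‖ * k)) := by
      rw [← Real.exp_add]; ring_nf
    rw [h2, mul_pow] at *
    have hCA' : 0 ≤ CA j i / ‖c j‖ := div_nonneg (hCA j i) (norm_nonneg _)
    calc CA j i / ‖c j‖ * (Kk * (2 * B + Real.sqrt ((2 * Real.pi * ‖Dσ‖ + 1) * k)) + B + 1) ^ NA j i *
          (Real.exp (B + 1) * Real.exp (-Real.sqrt (Real.pi * ‖Dσ‖ * k)))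
        ≤ CA j i / ‖c j‖ * (L ^ NA j i * (1 + Real.sqrt (Real.pi * ‖Dσ‖ * k)) ^ NA j i) *
          (Real.exp (B + 1) * Real.exp (-Real.sqrt (Real.pi * ‖Dσ‖ * k))) := by
          gcongr
      _ = CA j i / ‖c j‖ * L ^ NA j i * Real.exp (B + 1) *
          ((1 + Real.sqrt (Real.pi * ‖Dσ‖ * k)) ^ NA j i *
            Real.exp (-Real.sqrt (Real.pi * ‖Dσ‖ * k))) := by ring
  have hbig : ∀ᶠ k : ℕ in atTop, (B + 1) ^ 2 ≤ Real.pi * ‖Dσ‖ * k ∧ (1 : ℝ) ≤ k :=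
    ((tendsto_natCast_atTop_atTop.const_mul_atTop (mul_pos Real.pi_pos hDσpos)).eventually_ge_atTop
      _).and (tendsto_natCast_atTop_atTop.eventually_ge_atTop 1)
  obtain ⟨k, hk, ⟨hkB2, hk1⟩⟩ :=
    ((eventually_all.2 fun j => eventually_all.2 (hsmall j)).and hbig).exists
  have hkB : 2 * B + 1 ≤ Real.pi * ‖Dσ‖ * k := by nlinarith
  have hk0 : (0 : ℝ) < k := by linarith
  set E : (Fin s → ℂ) → ℂ := fun ζ =>
    ((βf (ℓ + ζ) - 1) / (2 * α)) ^ 2 - (g (ℓ + ζ) + 2 * Real.pi * I * σ * k) / α with hE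
  set τ : (Fin s → ℂ) → ℂ := fun ζ => -((βf (ℓ + ζ) - 1) / (2 * α)) + (E ζ) ^ ((2 : ℂ)⁻¹) with hτ
  set xf : (Fin s → ℂ) → (Fin s → ℂ) := fun ζ j => (κ j : ℂ) * τ ζ + ℓ j + ζ j with hxf
  have hEsplit : ∀ ζ, E ζ = ((2 * Real.pi * k : ℝ) : ℂ) * Dσ +
      (((βf (ℓ + ζ) - 1) / (2 * α)) ^ 2 - g (ℓ + ζ) / α) := by
    intro ζ
    simp only [hE, hDσ]
    push_cast
    field_simp
    ring
  have hest : ∀ ζ : Fin s → ℂ, ‖ζ‖ < 1 →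
      E ζ ∈ slitPlane ∧ Real.sqrt (Real.pi * ‖Dσ‖ * k) - B - 1 ≤ (τ ζ).re ∧
        ‖xf ζ‖ ≤ Kk * (2 * B + Real.sqrt ((2 * Real.pi * ‖Dσ‖ + 1) * k)) + B + 1 - 1 := by
    intro ζ hζ
    obtain ⟨hb1, hb2, hb3⟩ := hB ζ hζ.le
    obtain ⟨hsq, hwre, hre2⟩ := principalSqrt_facts (E ζ)
    set w : ℂ := (E ζ) ^ ((2 : ℂ)⁻¹) with hw
    set R : ℂ := ((βf (ℓ + ζ) - 1) / (2 * α)) ^ 2 - g (ℓ + ζ) / α with hR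
    have hRb : ‖R‖ ≤ B := hb2
    have hmain : 2 * Real.pi * k * ‖Dσ‖ - 2 * B ≤ ‖E ζ‖ + (E ζ).re := by
      rw [hEsplit ζ]
      have h1 : ‖((2 * Real.pi * k : ℝ) : ℂ) * Dσ + R‖ ≥ 2 * Real.pi * k * ‖Dσ‖ - ‖R‖ := by
        have := norm_sub_norm_le (((2 * Real.pi * k : ℝ) : ℂ) * Dσ) (-R)
        rw [sub_neg_eq_add, norm_neg, norm_mul, Complex.norm_real,
          Real.norm_of_nonneg (by positivity)] at this
        linarith
      have h2 : (((2 * Real.pi * k : ℝ) : ℂ) * Dσ + R).re = 2 * Real.pi * k * Dσ.re + R.re := by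
        rw [Complex.add_re, Complex.re_ofReal_mul]
      have h3 : -‖R‖ ≤ R.re := by have := Complex.abs_re_le_norm R; rw [abs_le] at this; exact this.1
      have h4 : 0 ≤ 2 * Real.pi * k * Dσ.re := by have : 0 ≤ Dσ.re := hσre; positivity
      rw [h2]; linarith
    have hEupp : ‖E ζ‖ ≤ 2 * Real.pi * k * ‖Dσ‖ + B := by
      rw [hEsplit ζ]
      refine (norm_add_le _ _).trans ?_
      rw [norm_mul, Complex.norm_real, Real.norm_of_nonneg (by positivity)]
      linarith
    have hpos : 0 < ‖E ζ‖ + (E ζ).re := by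
      have : 2 * B + 1 ≤ Real.pi * ‖Dσ‖ * k := hkB
      nlinarith
    have hslit : E ζ ∈ slitPlane := by
      rw [mem_slitPlane_iff]
      by_contra hcon
      rw [not_or, not_lt, not_ne_iff] at hcon
      obtain ⟨h1, h2⟩ := hcon
      have : |(E ζ).re| = ‖E ζ‖ := Complex.abs_re_eq_norm.mpr h2
      rw [← this, abs_of_nonpos h1] at hpos
      linarith
    refine ⟨hslit, ?_, ?_⟩
    · -- `Re τ ≥ Re w - B ≥ √(π‖Dσ‖k) - B - 1`
      have hw2 : Real.pi * ‖Dσ‖ * k - B ≤ w.re ^ 2 := by rw [hre2]; linarith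
      have hw3 : Real.sqrt (Real.pi * ‖Dσ‖ * k) - 1 ≤ w.re := by
        by_cases hcase : Real.pi * ‖Dσ‖ * k - B ≤ 0
        · exfalso
          have hP : 2 * B + 1 ≤ Real.pi * ‖Dσ‖ * k := hkB
          linarith
        · rw [not_le] at hcase
          have h1 : Real.sqrt (Real.pi * ‖Dσ‖ * k - B) ≤ w.re := by
            rw [← Real.sqrt_sq hwre]; exact Real.sqrt_le_sqrt hw2
          have hP : 2 * B + 1 ≤ Real.pi * ‖Dσ‖ * k := hkB
          have hsP : (B + 1) / 2 ≤ Real.sqrt (Real.pi * ‖Dσ‖ * k) := by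
            rw [Real.le_sqrt (by positivity) (by positivity)]
            nlinarith [hkB2]
          have h2 : Real.sqrt (Real.pi * ‖Dσ‖ * k) - 1 ≤ Real.sqrt (Real.pi * ‖Dσ‖ * k - B) := by
            by_cases hneg : Real.sqrt (Real.pi * ‖Dσ‖ * k) - 1 ≤ 0
            · exact hneg.trans (Real.sqrt_nonneg _)
            · rw [not_le] at hneg
              rw [Real.le_sqrt hneg.le hcase.le]
              have hss : Real.sqrt (Real.pi * ‖Dσ‖ * k) ^ 2 = Real.pi * ‖Dσ‖ * k :=
                Real.sq_sqrt (by positivity)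
              nlinarith
          linarith
      have hτre : (τ ζ).re = -((βf (ℓ + ζ) - 1) / (2 * α)).re + w.re := by simp [hτ, hw]
      have h5 : -((βf (ℓ + ζ) - 1) / (2 * α)).re ≥ -B := by
        have := Complex.abs_re_le_norm ((βf (ℓ + ζ) - 1) / (2 * α))
        rw [abs_le] at this; linarith [this.2]
      rw [hτre]; linarith
    · -- size of `x(ζ)`: `‖τ‖ ≤ B + ‖w‖`, `‖w‖ = √‖E‖ ≤ √(2π‖Dσ‖k + B)`
      have hwn : ‖w‖ ≤ Real.sqrt ((2 * Real.pi * ‖Dσ‖ + 1) * k) + B := by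
        have h1 : ‖w‖ ^ 2 = ‖E ζ‖ := by rw [← norm_pow, hsq]
        have h2 : ‖w‖ ≤ Real.sqrt ‖E ζ‖ := by rw [← h1, Real.sqrt_sq (norm_nonneg _)]
        have h3 : Real.sqrt ‖E ζ‖ ≤ Real.sqrt ((2 * Real.pi * ‖Dσ‖ + 1) * k + B ^ 2 + 2 * B *
            Real.sqrt ((2 * Real.pi * ‖Dσ‖ + 1) * k)) := by
          refine Real.sqrt_le_sqrt (hEupp.trans ?_)
          have := Real.sqrt_nonneg ((2 * Real.pi * ‖Dσ‖ + 1) * k)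
          nlinarith
        have h4 : (2 * Real.pi * ‖Dσ‖ + 1) * k + B ^ 2 + 2 * B * Real.sqrt ((2 * Real.pi * ‖Dσ‖ + 1) * k)
            = (Real.sqrt ((2 * Real.pi * ‖Dσ‖ + 1) * k) + B) ^ 2 := by
          rw [add_sq, Real.sq_sqrt (by positivity)]; ring
        rw [h4, Real.sqrt_sq (by positivity)] at h3
        linarith
      have hτn : ‖τ ζ‖ ≤ 2 * B + Real.sqrt ((2 * Real.pi * ‖Dσ‖ + 1) * k) := by
        calc ‖τ ζ‖ ≤ ‖-((βf (ℓ + ζ) - 1) / (2 * α))‖ + ‖w‖ := norm_add_le _ _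
          _ ≤ B + (Real.sqrt ((2 * Real.pi * ‖Dσ‖ + 1) * k) + B) := by rw [norm_neg]; exact add_le_add hb1 hwn
          _ = _ := by ring
      have hsq0 := Real.sqrt_nonneg ((2 * Real.pi * ‖Dσ‖ + 1) * k)
      have hKs : 0 ≤ Kk * (2 * B + Real.sqrt ((2 * Real.pi * ‖Dσ‖ + 1) * k)) :=
        mul_nonneg hKk0 (by linarith)
      rw [pi_norm_le_iff_of_nonneg (by linarith)]
      intro j
      show ‖(κ j : ℂ) * τ ζ + ℓ j + ζ j‖ ≤ _
      have h6 : ‖ℓ j + ζ j‖ ≤ B := (norm_le_pi_norm (ℓ + ζ) j).trans hb3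
      have h7 : ‖(κ j : ℂ) * τ ζ‖ ≤ Kk * (2 * B + Real.sqrt ((2 * Real.pi * ‖Dσ‖ + 1) * k)) := by
        rw [norm_mul, Complex.norm_natCast]
        exact mul_le_mul (hκK j) hτn (norm_nonneg _) hKk0
      calc ‖(κ j : ℂ) * τ ζ + ℓ j + ζ j‖ = ‖(κ j : ℂ) * τ ζ + (ℓ j + ζ j)‖ := by rw [add_assoc]
        _ ≤ ‖(κ j : ℂ) * τ ζ‖ + ‖ℓ j + ζ j‖ := norm_add_le _ _
        _ ≤ _ := by linarith
  have halg : ∀ ζ, g (xf ζ) = τ ζ - 2 * Real.pi * I * σ * k := by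
    intro ζ
    obtain ⟨hsq, -, -⟩ := principalSqrt_facts (E ζ)
    have hsum1 : ∑ i, ∑ l, M i l * ((κ i : ℂ) * τ ζ + ℓ i + ζ i) * ((κ l : ℂ) * τ ζ + ℓ l + ζ l) =
        α * τ ζ ^ 2 +
          (∑ i, ∑ l, M i l * ((κ i : ℂ) * (ℓ l + ζ l) + (κ l : ℂ) * (ℓ i + ζ i))) * τ ζ +
          ∑ i, ∑ l, M i l * (ℓ i + ζ i) * (ℓ l + ζ l) := by
      have hrow : ∀ i, ∑ l, M i l * ((κ i : ℂ) * τ ζ + ℓ i + ζ i) * ((κ l : ℂ) * τ ζ + ℓ l + ζ l) =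
          (∑ l, M i l * (κ i : ℂ) * (κ l : ℂ)) * τ ζ ^ 2 +
            (∑ l, M i l * ((κ i : ℂ) * (ℓ l + ζ l) + (κ l : ℂ) * (ℓ i + ζ i))) * τ ζ +
            ∑ l, M i l * (ℓ i + ζ i) * (ℓ l + ζ l) := by
        intro i
        rw [Finset.sum_mul, Finset.sum_mul, ← Finset.sum_add_distrib, ← Finset.sum_add_distrib]
        exact Finset.sum_congr rfl fun l _ => by ring
      rw [hαdef, Finset.sum_congr rfl fun i _ => hrow i, Finset.sum_add_distrib, Finset.sum_add_distrib,
        ← Finset.sum_mul, ← Finset.sum_mul]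
    have hsum2 : ∑ i, b i * ((κ i : ℂ) * τ ζ + ℓ i + ζ i) =
        (∑ i, b i * (κ i : ℂ)) * τ ζ + ∑ i, b i * (ℓ i + ζ i) := by
      rw [Finset.sum_mul, ← Finset.sum_add_distrib]
      exact Finset.sum_congr rfl fun i _ => by ring
    have hexp : g (xf ζ) = α * τ ζ ^ 2 + βf (ℓ + ζ) * τ ζ + g (ℓ + ζ) := by
      show (∑ i, ∑ l, M i l * ((κ i : ℂ) * τ ζ + ℓ i + ζ i) * ((κ l : ℂ) * τ ζ + ℓ l + ζ l) +
          ∑ i, b i * ((κ i : ℂ) * τ ζ + ℓ i + ζ i) + c₀) =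
        α * τ ζ ^ 2 +
          (∑ i, ∑ l, M i l * ((κ i : ℂ) * (ℓ + ζ) l + (κ l : ℂ) * (ℓ + ζ) i) + ∑ i, b i * (κ i : ℂ)) *
            τ ζ +
          (∑ i, ∑ l, M i l * (ℓ + ζ) i * (ℓ + ζ) l + ∑ i, b i * (ℓ + ζ) i + c₀)
      simp only [Pi.add_apply]
      rw [hsum1, hsum2]
      ring
    set pp : ℂ := (βf (ℓ + ζ) - 1) / (2 * α) with hpp
    set qq : ℂ := (g (ℓ + ζ) + 2 * Real.pi * I * σ * k) / α with hqq
    have hEpq : E ζ = pp ^ 2 - qq := rfl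
    have hτpq : τ ζ = -pp + (E ζ) ^ ((2 : ℂ)⁻¹) := rfl
    have hp' : βf (ℓ + ζ) - 1 = 2 * α * pp := by rw [hpp]; field_simp
    have hq' : g (ℓ + ζ) + 2 * Real.pi * I * σ * k = α * qq := by rw [hqq]; field_simp
    have hquad : α * τ ζ ^ 2 + (βf (ℓ + ζ) - 1) * τ ζ + (g (ℓ + ζ) + 2 * Real.pi * I * σ * k) = 0 := by
      rw [hp', hq', hτpq]
      have : α * (-pp + (E ζ) ^ ((2 : ℂ)⁻¹)) ^ 2 + 2 * α * pp * (-pp + (E ζ) ^ ((2 : ℂ)⁻¹)) + α * qq =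
          α * (((E ζ) ^ ((2 : ℂ)⁻¹)) ^ 2 - (pp ^ 2 - qq)) := by ring
      rw [this, hsq, hEpq, sub_self, mul_zero]
    linear_combination hexp + hquad
  set G : Fin s → (Fin s → ℂ) → ℂ := fun j ζ =>
    (∑ i : Fin K, eval (xf ζ) (A j i) * exp (-((((i : ℕ) + 1 : ℕ) : ℂ) * τ ζ))) * (c j)⁻¹ with hG
  have hGdiff : ∀ j, DifferentiableOn ℂ (G j) (ball 0 1) := by
    intro j
    have hβd : Differentiable ℂ fun ζ : Fin s → ℂ => (βf (ℓ + ζ) - 1) / (2 * α) := by simp only [hβf]; fun_prop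
    have hEd : Differentiable ℂ E := by
      show Differentiable ℂ fun ζ =>
        ((βf (ℓ + ζ) - 1) / (2 * α)) ^ 2 - (g (ℓ + ζ) + 2 * Real.pi * I * σ * k) / α
      simp only [hβf, hgdef]; fun_prop
    have hτd : DifferentiableOn ℂ τ (ball 0 1) := by
      have h1 : DifferentiableOn ℂ (fun ζ => (E ζ) ^ ((2 : ℂ)⁻¹)) (ball 0 1) :=
        hEd.differentiableOn.cpow (differentiableOn_const _) fun ζ hζ =>
          (hest ζ (by rwa [mem_ball, dist_zero_right] at hζ)).1
      show DifferentiableOn ℂ (fun ζ => -((βf (ℓ + ζ) - 1) / (2 * α)) + (E ζ) ^ ((2 : ℂ)⁻¹)) _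
      exact hβd.neg.differentiableOn.add h1
    have hxd : DifferentiableOn ℂ xf (ball 0 1) := by
      refine differentiableOn_pi.2 fun j => ?_
      show DifferentiableOn ℂ (fun ζ => (κ j : ℂ) * τ ζ + ℓ j + ζ j) _
      exact ((hτd.const_mul _).add_const _).add (differentiable_apply j).differentiableOn
    have hsum : DifferentiableOn ℂ (fun ζ => ∑ i : Fin K,
        eval (xf ζ) (A j i) * exp (-((((i : ℕ) + 1 : ℕ) : ℂ) * τ ζ))) (ball 0 1) := by
      apply DifferentiableOn.fun_sum
      intro i _
      exact ((differentiable_mvPolynomial_eval (A j i)).comp_differentiableOn hxd).mul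
        ((hτd.const_mul ((((i : ℕ) + 1 : ℕ) : ℂ))).neg.cexp)
    exact hsum.mul_const _
  have hGb : ∀ j, ∀ ζ ∈ ball (0 : Fin s → ℂ) 1, ‖G j ζ‖ ≤ 1 / (16 * ((s : ℝ) + 1)) := by
    intro j ζ hζ
    rw [mem_ball, dist_zero_right] at hζ
    obtain ⟨-, hre, hxn⟩ := hest ζ hζ
    have hcj : 0 < ‖c j‖ := norm_pos_iff.mpr (hc j)
    have hsqB : B + 1 ≤ Real.sqrt (Real.pi * ‖Dσ‖ * k) := by
      rw [Real.le_sqrt (by positivity) (by positivity)]; exact hkB2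
    have hτ0 : 0 ≤ (τ ζ).re := by linarith
    have hbase0 : 0 ≤ Kk * (2 * B + Real.sqrt ((2 * Real.pi * ‖Dσ‖ + 1) * k)) + B + 1 := by
      have := Real.sqrt_nonneg ((2 * Real.pi * ‖Dσ‖ + 1) * k)
      have hKs : 0 ≤ Kk * (2 * B + Real.sqrt ((2 * Real.pi * ‖Dσ‖ + 1) * k)) :=
        mul_nonneg hKk0 (by linarith)
      linarith
    have hterm : ∀ i : Fin K, ‖eval (xf ζ) (A j i) * exp (-((((i : ℕ) + 1 : ℕ) : ℂ) * τ ζ))‖ * ‖c j‖⁻¹ ≤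
        1 / (16 * ((s : ℝ) + 1)) / ((K : ℝ) + 1) := by
      intro i
      have hAx : ‖eval (xf ζ) (A j i)‖ ≤
          CA j i * (Kk * (2 * B + Real.sqrt ((2 * Real.pi * ‖Dσ‖ + 1) * k)) + B + 1) ^ NA j i := by
        refine (hCNA j i _).trans (mul_le_mul_of_nonneg_left ?_ (hCA j i))
        exact pow_le_pow_left₀ (by positivity) (by linarith) _
      have h1i : (1 : ℝ) ≤ (((i : ℕ) + 1 : ℕ) : ℝ) := by exact_mod_cast Nat.succ_pos _
      have hmre : (τ ζ).re ≤ (((i : ℕ) + 1 : ℕ) : ℝ) * (τ ζ).re := le_mul_of_one_le_left hτ0 h1i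
      have hex : Real.exp (-((((i : ℕ) + 1 : ℕ) : ℝ) * (τ ζ).re)) ≤
          Real.exp (-(Real.sqrt (Real.pi * ‖Dσ‖ * k) - B - 1)) := Real.exp_le_exp.mpr (by linarith)
      have hre_mul : (-((((i : ℕ) + 1 : ℕ) : ℂ) * τ ζ)).re = -((((i : ℕ) + 1 : ℕ) : ℝ) * (τ ζ).re) := by
        simp [Complex.mul_re]
      rw [norm_mul, Complex.norm_exp, hre_mul]
      calc ‖eval (xf ζ) (A j i)‖ * Real.exp (-((((i : ℕ) + 1 : ℕ) : ℝ) * (τ ζ).re)) * ‖c j‖⁻¹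
          ≤ CA j i * (Kk * (2 * B + Real.sqrt ((2 * Real.pi * ‖Dσ‖ + 1) * k)) + B + 1) ^ NA j i *
              Real.exp (-(Real.sqrt (Real.pi * ‖Dσ‖ * k) - B - 1)) * ‖c j‖⁻¹ :=
            mul_le_mul_of_nonneg_right (mul_le_mul hAx hex (Real.exp_pos _).le
              (mul_nonneg (hCA j i) (pow_nonneg hbase0 _))) (inv_nonneg.mpr (norm_nonneg _))
        _ = CA j i / ‖c j‖ * (Kk * (2 * B + Real.sqrt ((2 * Real.pi * ‖Dσ‖ + 1) * k)) + B + 1) ^ NA j i *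
              Real.exp (-(Real.sqrt (Real.pi * ‖Dσ‖ * k) - B - 1)) := by ring
        _ ≤ _ := hk j i
    have hnorm : ‖G j ζ‖ ≤
        ∑ i : Fin K, ‖eval (xf ζ) (A j i) * exp (-((((i : ℕ) + 1 : ℕ) : ℂ) * τ ζ))‖ * ‖c j‖⁻¹ := by
      rw [← Finset.sum_mul]
      show ‖(∑ i : Fin K, eval (xf ζ) (A j i) * exp (-((((i : ℕ) + 1 : ℕ) : ℂ) * τ ζ))) * (c j)⁻¹‖ ≤ _
      rw [norm_mul, norm_inv]
      exact mul_le_mul_of_nonneg_right (norm_sum_le _ _) (inv_nonneg.mpr (norm_nonneg _))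
    have hKfrac : (K : ℝ) * (1 / (16 * ((s : ℝ) + 1)) / ((K : ℝ) + 1)) ≤ 1 / (16 * ((s : ℝ) + 1)) := by
      rw [mul_div_assoc', div_le_iff₀ (by positivity : (0 : ℝ) < (K : ℝ) + 1)]
      nlinarith [hε]
    calc ‖G j ζ‖ ≤ ∑ _i : Fin K, 1 / (16 * ((s : ℝ) + 1)) / ((K : ℝ) + 1) :=
          hnorm.trans (Finset.sum_le_sum fun i _ => hterm i)
      _ = (K : ℝ) * (1 / (16 * ((s : ℝ) + 1)) / ((K : ℝ) + 1)) := by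
          rw [Finset.sum_const, Finset.card_univ, Fintype.card_fin, nsmul_eq_mul]
      _ ≤ _ := hKfrac
  obtain ⟨ζ, hζ, hfix⟩ := Literature.NumberTheory.Transcendental.ExpDominant.exists_exp_eq_one_add
    G hε.le (le_of_eq (by field_simp : (16 : ℝ) * ((s : ℝ) + 1) * (1 / (16 * ((s : ℝ) + 1))) = 1))
    hGdiff hGb
  refine ⟨xf ζ, fun j => ?_⟩
  have hk1' : exp (-(2 * Real.pi * I * σ * k)) = 1 := by
    obtain ⟨n, hn⟩ : ∃ n : ℤ, -(2 * Real.pi * I * σ * k) = n * (2 * Real.pi * I) := by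
      rcases hσ with h | h
      · exact ⟨-(k : ℤ), by rw [h]; push_cast; ring⟩
      · exact ⟨(k : ℤ), by rw [h]; push_cast; ring⟩
    rw [hn]; exact Complex.exp_int_mul_two_pi_mul_I n
  have hgx : exp (∑ i, ∑ l, M i l * xf ζ i * xf ζ l + ∑ i, b i * xf ζ i + c₀) = exp (τ ζ) := by
    have : (∑ i, ∑ l, M i l * xf ζ i * xf ζ l + ∑ i, b i * xf ζ i + c₀) = g (xf ζ) := rfl
    rw [this, halg, sub_eq_add_neg, Complex.exp_add, hk1', mul_one]
  have hpow : ∀ n : ℕ, exp (τ ζ) ^ n = exp ((n : ℂ) * τ ζ) := fun n => (Complex.exp_nat_mul _ n).symm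
  have hpowinv : ∀ n : ℕ, (exp (τ ζ) ^ n)⁻¹ = exp (-((n : ℂ) * τ ζ)) := fun n => by rw [hpow, exp_neg]
  simp_rw [hgx, hpowinv, hpow]
  show exp ((κ j : ℂ) * τ ζ + ℓ j + ζ j) = exp ((κ j : ℂ) * τ ζ) *
    (c j + ∑ i : Fin K, eval (xf ζ) (A j i) * exp (-((((i : ℕ) + 1 : ℕ) : ℂ) * τ ζ)))
  rw [Complex.exp_add, Complex.exp_add, hexpℓ j, hfix j]
  show exp ((κ j : ℂ) * τ ζ) * c j *
      (1 + (∑ i : Fin K, eval (xf ζ) (A j i) * exp (-((((i : ℕ) + 1 : ℕ) : ℂ) * τ ζ))) * (c j)⁻¹) =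
    exp ((κ j : ℂ) * τ ζ) * (c j + ∑ i : Fin K, eval (xf ζ) (A j i) * exp (-((((i : ℕ) + 1 : ℕ) : ℂ) * τ ζ)))
  have hcj : c j ≠ 0 := hc j
  generalize (∑ i : Fin K, eval (xf ζ) (A j i) * exp (-((((i : ℕ) + 1 : ℕ) : ℂ) * τ ζ))) = S
  field_simp
end Summit.Schanuel.Schanuel.Theorems
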